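import Summits.QuantumFields.YangMills.Theorems.BalabanUVNodesN06GDSupSqLegAtPinsPUWI
import Summits.QuantumFields.YangMills.Theorems.BalabanUVNodesN06D2SupLegAtPinsPUW
import Summits.QuantumFields.YangMills.Theorems.BalabanUVNodesN06SectDUnitsAtPinsPhys
import Literature.MathematicalPhysics.QuantumFieldTheory.Balaban1983to89.B9Thm312WholeFormSmallFromL2

/-!
# N06 [B9] — (3.137) BEFORE THE CERTIFICATE'S L² STEP: the `hD2sup` letter from the Δ⁽²⁾-free G₀ core, the T_π half of the L² step and the (3.132) letter
# (programme P-D2, cut B″ of dag-n06-d's ⚑ LOCATED-D2-CYCLE; replaces the withdrawn drop-in layer twin)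

T. Bałaban, *Propagators for lattice gauge theories in a background field*, Commun. Math. Phys. **99** (1985) 389–434 [`Balaban1985BackgroundPropagators`, "B9"], Thm 3.12
pp. 421–423 in print's order: G (3.130) [(Δ_a − Δ′_π)G = 1 from Thm 3.11's form bound for Δ′_π alone, (3.122)] → H (3.133) → Δ⁽²⁾ (3.134)–(3.137) → G₁ (3.138); (3.42) p. 397,
(3.46) p. 398, (3.36) p. 396, p. 421; [5] = T. Bałaban, *Averaging operations for lattice gauge theories*, Commun. Math. Phys. **98** (1985) 17–51 [`Balaban1985Averaging`],
(149) p. 40; [4] = T. Bałaban, *Propagators and renormalization transformations for lattice gauge theories. II*, Commun. Math. Phys. **96** (1984) 223–250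
[`Balaban1984PropagatorsII`], (2.51)–(2.56), Lemma 2.1 (2.60)–(2.61) pp. 232–234.

WHY (cell `pub-ymgap`, node N06, bundle F7 rows 20–21, seat dag-n06-l g33).  dag-n06-d's LOCATED-D2-CYCLE (2026-08-30): in the certificate the (3.137) letter `hD2sup` is
consumed by the block-L² step, whose output feeds the G₀ bundle `…GUSP` (FormSmall ∕ Identities), whose outputs feed the U8 state layer — so a derivation of `hD2sup` may
use NEITHER the L² step NOR the `Identities` record.  THIS FILE does exactly that, in print's order: (i) the T_π HALF of the L² step (`htpi`, n06-w8's
`blockBd_tpi_of_letter_schemasR`, Δ⁽²⁾-free) with the G₀ data of the Δ⁽²⁾-free core `…GUSPC.g0_core_of_thm310_coreDir₃USP` (`hsym12`, `hpos12`, `hinvG0`, the L² block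
`hl0`) gives Thm 3.11's relative form bound for Δ′_π ALONE (this lineage's `abs_form_le_of_stepBlockBd` + `weightedL2_le_form_of_l0`), hence — at the flat model of
Δ⁽²⁾_π, which is the ZERO operator — the unit `Δ_a − Δ′_π` (`isUnit_deltaPiAY_of_formSmall_phys`) and def-Y's `(Δ_a − Δ′_π)·G = 1` at the pins
(`S0coK_sub_TpicoK_mul_GcoK_GDY`); (ii) PASS 1 `…GDSupSqLegAtPinsPUWI.gdsup_sq_of_pins_inv` (the state layer at the flat residual + the regular-state resolvent entry)
gives the scaled sup letter of `G_D`; (iii) `…D2SupLegAtPinsPUW.d2sup_of_pins` (n06-w8's transpose road, scaled, at `G′_phys`, [5] (149) at print's weight) gives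
(3.137).  ★★★ `d2sup_prechain_of_pins`: binders = the state layer's VERBATIM (raised to `θ : Stage3Params`) minus `hT2co12 θ₂ hθ₂ hD2`, plus `𝔠 hΔ2def ha₀ hinvG0 hpos12
hsym12 hl0 htpi` (+ numerics `BL0 δL0 t2L δT σF`), `ρG`, pins `hS0co12 hblkZ12 hGco12 hCco12`, `hRP2`, `hc2 hC2` (+ `Bz δC κC δC2`); output `∃ MD aD θ₂, 0 < aD ≤ a₀ ∧ 0 ≤ θ₂ ∧`
the certificate's `hD2sup` family VERBATIM (at `Δ2 x`), to be fed to its L² step, its `hrgdd13` leg and its state layer.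
HONEST LABEL: helper (composition of landed faces by name), count-neutral; every analytic member a displayed HYPOTHESIS of printed species ([5] (149) included); N06
NOT discharged; nothing continuum ∕ OS ∕ mass gap ∕ Clay.  NEW file; nothing landed is modified.
-/

noncomputable section

namespace Summit.QuantumFields.YangMills.BalabanUVNodes.N06D2SupPrechainAtPinsPUW

open Literature.MathematicalPhysics.QuantumFieldTheory.Balaban1983to89
open Literature.MathematicalPhysics.QuantumFieldTheory.Balaban1983to89.Node00 (FBondY IBondY SiteY CfgY SiteParY SiteOpY parSymY GpY GpPhysY BondOpY parBY BondParY)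
open Literature.MathematicalPhysics.QuantumFieldTheory.Balaban1983to89.Node00.OpsYSectDCoords (DvcoKH DvscoKH TpicoK T2coK cR39_trBasis_pos)
open B9Thm39ReadingCoords (cR39 coordBound39 basisBound39)
open B9Thm34Ext (toB6)
open B11SectG (HasMaj BlockNorm)
open B9Thm312Whole (cNorm GeoOK)
open B9Thm312WholeClasses (cNormR rwt rwt_nonneg)
open B9CoReadingCoords (XBK blkBK coordOpK cdBₗ)
open B9CoReadingCoordsS (XSK sIK blkSK GcoS)
open B9CoReadingCoordsH (XHK)
open B9CoReadingCoordsTranspose (TrIdx trBasis)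
open B9PinMembersKLevelV1 (MemberY geo9Y)
open B9BackgroundsKLevelV1R (RegFamY bg9YR MemOfFam)
open B9GeoLemma21KLevelV1 (geo9Y_len_pos geo9Y_dist_triangle geo9Y_dist_comm)
open B9GeoNormsKLevelV1 (geo9K geo9K_dist_nonneg)
open B7Prop2SpecialUnitary (specialUnitaryUnits)
open B9PerturbationMajorantAlgebra (Proj349Maj Thm31GpMaj hasMaj_weaken)
open B9PerturbationMajorantsAtLetters (PcoK)
open B9MultiscaleSmoothPartitionYNear (rNear)
open B9MultiscaleSmoothPartitionYLip (CLip CLip_nonneg)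
open B9SmoothHolderClassP (bHZKP bHZKPG bHZPG)
open B9GradViaDivLettersTransported (taxiB taxiS)
open B9PerturbationSplitAtLetters (TaLcoK TbLcoKH Ta2LcoK Tb2LcoKH)
open B9PerturbationL2Delta2 (D2coK)
open B9SmoothHolderClassPProducers (CTel CTel_nonneg)
open B9RowSum261DefiniteFaces (rowConst261 rowConst261_nonneg)
open B9SectDSup (weightNorm)
open B6RandomWalk (HasMajorant)
open B6RandomWalkHom (HasMajorantHom)
open B9Thm312WholeStepRegular (StepS LettersS3131)
open B9CoReadingCoordsHolder (PK)
open B9CoReadingCoordsHolderAdm (holderProbesKA)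
open B9RWSums343Holder (HolderProbes)
open B9PerturbationMajorantAlgebra (CurrentMaj)
open B9PerturbationMajorantsAtLetters (BcoKH BdcoKH)
open B9Thm313WholeDir (Thm33G0DirR)
open B9Thm313WholeDirInputBC (Letters313IML)
open B9LettersHZAtOne (plateau_pos)
open B9CoReadingCoordsInput (bHK) open B9CoReadingCoordsInputS (bHS)
open B9CoRealizesRelAtLetters (RelB)
open B9Thm33G0ProbeZeroAtCutPins (pX0_of_pins)
open B6GlobalChartV1 (blkV1) open B6Ineq2142KLevelV1 (β lvl) open B6Geom246MultiLevelTorus (geomT)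
open Summit.QuantumFields.YangMills.BalabanUVNodes.N06HolderPinsGradedAtRecord (links_le_one)
open Summit.QuantumFields.YangMills.BalabanUVNodes.N06TbHLegAtPinsPhysPU (htbH_of_pinsP43_geo9Y)
open Summit.QuantumFields.YangMills.BalabanUVNodes.N06LettersSAtPinsPU (hLettersS_of_pinsP44_geo9Y)
open Summit.QuantumFields.YangMills.BalabanUVNodes.N06StateClassFactsAtPinsPU (hStateFacts_of_pinsP_geo9Y)
open Summit.QuantumFields.YangMills.BalabanUVNodes.N06StateProducerG0AtPinsPU (hG0S2_of_pinsP_geo9Y)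
open Summit.QuantumFields.YangMills.BalabanUVNodes.N06StateProducersAAtPinsPU (hProducersA_of_pinsP_geo9Y)
open Summit.QuantumFields.YangMills.BalabanUVNodes.N06StateProducersBAtPinsPUW (hProducersBW_of_pinsP_geo9Y)
open Summit.QuantumFields.YangMills.BalabanUVNodes.N06StatePairsAtPinsPU (hStatePairs_of_pinsP_geo9Y)
open Summit.QuantumFields.YangMills.BalabanUVNodes.N06StateAssemblyAtPinsPUW (hStateAssemblyW_of_faces)
open scoped Matrix.Norms.L2Operator
open Summit.QuantumFields.YangMills.BalabanUVNodes.N06GDSupSqLegAtPinsPUWI (gdsup_sq_of_pins_inv)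
open Summit.QuantumFields.YangMills.BalabanUVNodes.N06D2SupLegAtPinsPUW (d2sup_of_pins)
open Summit.QuantumFields.YangMills.BalabanUVNodes.N06SectDUnitsAtPinsPhys (isUnit_deltaPiAY_of_formSmall_phys)
open Literature.MathematicalPhysics.QuantumFieldTheory.Balaban1983to89.Node00 (Stage3Params C2Y delta2OfY trDualMatY delta2PiY)
open Literature.MathematicalPhysics.QuantumFieldTheory.Balaban1983to89.Node00.OpsYSectDCoords (S0coK CcoK S0coK_sub_TpicoK_mul_GcoK_GDY)
open Literature.MathematicalPhysics.QuantumFieldTheory.Balaban1983to89.B9BackgroundsKLevelV1P (bg9YP)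
open Literature.MathematicalPhysics.QuantumFieldTheory.Balaban1983to89.B9PinGeometryKLevelV1 (c35Y)
open Literature.MathematicalPhysics.QuantumFieldTheory.Balaban1983to89.B9Eq3132SectDLetters (GDY)
open Literature.MathematicalPhysics.QuantumFieldTheory.Balaban1983to89.B9Thm312Whole (FormSmall PosDefEnd)
open Literature.MathematicalPhysics.QuantumFieldTheory.Balaban1983to89.B9SectDL2Decay (bl2)
open Literature.MathematicalPhysics.QuantumFieldTheory.Balaban1983to89.B9Thm312WholeFormSmallFromL2 (abs_form_le_of_stepBlockBd weightedL2_le_form_of_l0)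
open Literature.MathematicalPhysics.QuantumFieldTheory.Balaban1983to89.B11SectG (RowSum)
open Literature.MathematicalPhysics.QuantumFieldTheory.Balaban1983to89.B9GeoLemma21KLevelV1 (rowSum261_geo9Y)
open B9CoReadingCoords (GcoK)
open B9CoReadingCoordsH (blkHK)
open B9Delta2FormMajorant (C2FormMaj)

variable {N : ℕ} {θ : Stage3Params} {Mstar : ℕ}

set_option maxHeartbeats 3200000 in
/-- ★★★ **(3.137) BEFORE THE L² STEP** (module docstring): `∃ MD aD θ₂, 0 < aD ≤ a₀ ∧ 0 ≤ θ₂ ∧` the certificate's `hD2sup` family at `Δ2 x`, from the state layer's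
Δ⁽²⁾-free inputs, the G₀ core's resolvent data, the T_π half of the L² step, the (3.132) class letter and [5] (149).
[cite: Balaban1985BackgroundPropagators, Thm 3.12 pp.421–423 + Thm 3.11 p.416 + (3.42) p.397 + (3.46) p.398; Balaban1985Averaging, (149) p.40; Balaban1984PropagatorsII, (2.51)–(2.56) pp.232–233 + Lemma 2.1 (2.60)–(2.61) p.234] -/
theorem d2sup_prechain_of_pins [NeZero N] [∀ x : MemberY θ.d₆ θ.ℓ₆ θ.hd' θ.hL' θ.b₀ θ.b₁ Mstar, Fintype (geo9Y x).Site] [∀ x : MemberY θ.d₆ θ.ℓ₆ θ.hd' θ.hL' θ.b₀ θ.b₁ Mstar, DecidableRel (RelB x.toKIdx)]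
    {R₁ R₂ : RegFamY θ.d₆ θ.ℓ₆ θ.hd' θ.hL' θ.b₀ θ.b₁ Mstar (Matrix (Fin N) (Fin N) ℂ)} (H : MemberY θ.d₆ θ.ℓ₆ θ.hd' θ.hL' θ.b₀ θ.b₁ Mstar → Prop)
    (bI : ∀ x : MemberY θ.d₆ θ.ℓ₆ θ.hd' θ.hL' θ.b₀ θ.b₁ Mstar, FBondY x.toKIdx → IBondY x.toKIdx)
    (hlev : ∀ (x : MemberY θ.d₆ θ.ℓ₆ θ.hd' θ.hL' θ.b₀ θ.b₁ Mstar) (f : FBondY x.toKIdx), lvl x.hN x.D x.hk (bI x f) = (blkV1 x.hN x.D f).1.1)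
    (hβ1 : ∀ (x : MemberY θ.d₆ θ.ℓ₆ θ.hd' θ.hL' θ.b₀ θ.b₁ Mstar) (f : FBondY x.toKIdx), (geomT x.D).dist (β x.hN x.D x.hk (bI x f)) (blkV1 x.hN x.D f) ≤ 1)
    (hbI0 : ∀ (x : MemberY θ.d₆ θ.ℓ₆ θ.hd' θ.hL' θ.b₀ θ.b₁ Mstar) (f : FBondY x.toKIdx), bI x f = bI x ⟨f.src, 0⟩)
    (hGR : MemOfFam (specialUnitaryUnits (Fin N)) R₁)
    (c : ℝ) {M₀ a₀ : ℝ} (hM₀ : 0 ≤ M₀) {σ τ : ℝ} (hσ : 0 < σ) (hτ : 0 < τ)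
    (w13 : ℝ → ℝ) (hw13₀ : ∀ s, 0 ≤ w13 s) (hw13₁ : ∀ s, w13 s ≤ 1) (wX : ℝ → ℝ) (hwX₀ : ∀ s, 0 ≤ wX s) (hwX₁ : ∀ s, wX s ≤ 1)
    {s44 : ℝ} (hs440 : 0 < s44) (hs441 : s44 < 1) (hw1344 : 0 < w13 s44) (hwX44 : 0 < wX s44)
    (bH13 : ∀ x : MemberY θ.d₆ θ.ℓ₆ θ.hd' θ.hL' θ.b₀ θ.b₁ Mstar, (bg9YR (Matrix (Fin N) (Fin N) ℂ) (specialUnitaryUnits (Fin N)) R₁ R₂ x).Cfg → BlockNorm (toB6 (geo9Y x) 1 (H x)) (XSK (TrIdx N) x.toKIdx → ℝ))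
    (hbH13 : ∀ (x : MemberY θ.d₆ θ.ℓ₆ θ.hd' θ.hL' θ.b₀ θ.b₁ Mstar) (U : (bg9YR (Matrix (Fin N) (Fin N) ℂ) (specialUnitaryUnits (Fin N)) R₁ R₂ x).Cfg), bH13 x U =
      letI : Fintype (geo9K x.toKIdx).Site := (inferInstance : Fintype (geo9Y x).Site);
      bHZPG (κ := TrIdx N) x.toKIdx (trBasis N) (taxiS x.toKIdx (bg9YR (Matrix (Fin N) (Fin N) ℂ) (specialUnitaryUnits (Fin N)) R₁ R₂ x) (fun U => U) U) (R := (1 : ℝ)) (H := H x) w13 hw13₀ hw13₁)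
    (hκ13 : ∀ (x : MemberY θ.d₆ θ.ℓ₆ θ.hd' θ.hL' θ.b₀ θ.b₁ Mstar) (U : (bg9YR (Matrix (Fin N) (Fin N) ℂ) (specialUnitaryUnits (Fin N)) R₁ R₂ x).Cfg), (bH13 x U).κ ≤ 1 + CLip θ.d₆ θ.ℓ₆)
    (bXH : ∀ x : MemberY θ.d₆ θ.ℓ₆ θ.hd' θ.hL' θ.b₀ θ.b₁ Mstar, (bg9YR (Matrix (Fin N) (Fin N) ℂ) (specialUnitaryUnits (Fin N)) R₁ R₂ x).Cfg → BlockNorm (toB6 (geo9Y x) 1 (H x)) (XBK (TrIdx N) x.toKIdx → ℝ))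
    (hbXH : ∀ (x : MemberY θ.d₆ θ.ℓ₆ θ.hd' θ.hL' θ.b₀ θ.b₁ Mstar) (U : (bg9YR (Matrix (Fin N) (Fin N) ℂ) (specialUnitaryUnits (Fin N)) R₁ R₂ x).Cfg), bXH x U =
      letI : Fintype (geo9K x.toKIdx).Site := (inferInstance : Fintype (geo9Y x).Site);
      bHZKPG (κ := TrIdx N) x.toKIdx (trBasis N) (taxiB x.toKIdx (bg9YR (Matrix (Fin N) (Fin N) ℂ) (specialUnitaryUnits (Fin N)) R₁ R₂ x) (fun U => U) U) (R := (1 : ℝ)) (H := H x) wX hwX₀ hwX₁)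
    (bHXA : ∀ x : MemberY θ.d₆ θ.ℓ₆ θ.hd' θ.hL' θ.b₀ θ.b₁ Mstar, ℝ → BlockNorm (toB6 (geo9Y x) 1 (H x)) (XBK (TrIdx N) x.toKIdx → ℝ))
    (hbHXA : ∀ x : MemberY θ.d₆ θ.ℓ₆ θ.hd' θ.hL' θ.b₀ θ.b₁ Mstar, bHXA x = fun ε => letI : Fintype (geo9K x.toKIdx).Site := (inferInstance : Fintype (geo9Y x).Site); bHK x.toKIdx (bI x) ε)
    (bW : ∀ x : MemberY θ.d₆ θ.ℓ₆ θ.hd' θ.hL' θ.b₀ θ.b₁ Mstar, (bg9YR (Matrix (Fin N) (Fin N) ℂ) (specialUnitaryUnits (Fin N)) R₁ R₂ x).Cfg → ℝ → BlockNorm (toB6 (geo9Y x) 1 (H x)) (XSK (TrIdx N) x.toKIdx → ℝ))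
    (𝔬12 : ∀ x : MemberY θ.d₆ θ.ℓ₆ θ.hd' θ.hL' θ.b₀ θ.b₁ Mstar, B9Thm312Whole.Ops (geo9Y x) (bg9YR (Matrix (Fin N) (Fin N) ℂ) (specialUnitaryUnits (Fin N)) R₁ R₂ x) (XBK (TrIdx N) x.toKIdx) (XBK (TrIdx N) x.toKIdx) (XHK (TrIdx N) x.toKIdx) (XSK (TrIdx N) x.toKIdx))
    (hblk12 : ∀ x : MemberY θ.d₆ θ.ℓ₆ θ.hd' θ.hL' θ.b₀ θ.b₁ Mstar, (𝔬12 x).blk = blkBK x.toKIdx (bI x))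
    (hblkW12 : ∀ x : MemberY θ.d₆ θ.ℓ₆ θ.hd' θ.hL' θ.b₀ θ.b₁ Mstar, (𝔬12 x).blkW = blkSK x.toKIdx (sIK x.toKIdx (bI x)))
    (𝔠 : C2Y N θ Mstar)
    (Δ2 : ∀ x : MemberY θ.d₆ θ.ℓ₆ θ.hd' θ.hL' θ.b₀ θ.b₁ Mstar, BondOpY (Matrix (Fin N) (Fin N) ℂ) x.toKIdx)
    (hΔ2def : ∀ x : MemberY θ.d₆ θ.ℓ₆ θ.hd' θ.hL' θ.b₀ θ.b₁ Mstar, Δ2 x = (delta2OfY (trDualMatY N) x.toKIdx (parSymY x.toKIdx) (parBY x.toKIdx) (GpPhysY x.toKIdx (parSymY x.toKIdx)) (𝔠 x).form))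
    (hTpico12 : ∀ (x : MemberY θ.d₆ θ.ℓ₆ θ.hd' θ.hL' θ.b₀ θ.b₁ Mstar) (U : (bg9YR (Matrix (Fin N) (Fin N) ℂ) (specialUnitaryUnits (Fin N)) R₁ R₂ x).Cfg), (𝔬12 x).Tpi U = TpicoK x.toKIdx (trBasis N) (bg9YR (Matrix (Fin N) (Fin N) ℂ) (specialUnitaryUnits (Fin N)) R₁ R₂ x) (fun U => U) (parSymY x.toKIdx) (GpPhysY x.toKIdx (parSymY x.toKIdx)) U)
    (hDvco12 : ∀ (x : MemberY θ.d₆ θ.ℓ₆ θ.hd' θ.hL' θ.b₀ θ.b₁ Mstar) (U : (bg9YR (Matrix (Fin N) (Fin N) ℂ) (specialUnitaryUnits (Fin N)) R₁ R₂ x).Cfg), (𝔬12 x).Dv U = DvcoKH x.toKIdx (trBasis N) (bg9YR (Matrix (Fin N) (Fin N) ℂ) (specialUnitaryUnits (Fin N)) R₁ R₂ x) (fun U => U) U)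
    (hDvsco12 : ∀ (x : MemberY θ.d₆ θ.ℓ₆ θ.hd' θ.hL' θ.b₀ θ.b₁ Mstar) (U : (bg9YR (Matrix (Fin N) (Fin N) ℂ) (specialUnitaryUnits (Fin N)) R₁ R₂ x).Cfg), (𝔬12 x).Dvstar U = DvscoKH x.toKIdx (trBasis N) (bg9YR (Matrix (Fin N) (Fin N) ℂ) (specialUnitaryUnits (Fin N)) R₁ R₂ x) (fun U => U) U)
    (𝔭A : ∀ x : MemberY θ.d₆ θ.ℓ₆ θ.hd' θ.hL' θ.b₀ θ.b₁ Mstar, HolderProbes (geo9Y x) (bg9YR (Matrix (Fin N) (Fin N) ℂ) (specialUnitaryUnits (Fin N)) R₁ R₂ x) (XBK (TrIdx N) x.toKIdx) (XBK (TrIdx N) x.toKIdx) (PK (FBondY x.toKIdx) (Fin (θ.d₆ + 1)) (TrIdx N)) (PK (FBondY x.toKIdx) (Fin (θ.d₆ + 1)) (TrIdx N)))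
    {parB : ∀ x : MemberY θ.d₆ θ.ℓ₆ θ.hd' θ.hL' θ.b₀ θ.b₁ Mstar, BondParY (Matrix (Fin N) (Fin N) ℂ) x.toKIdx}
    (hparB : ∀ x : MemberY θ.d₆ θ.ℓ₆ θ.hd' θ.hL' θ.b₀ θ.b₁ Mstar, parB x = parBY x.toKIdx)
    (h𝔭A : ∀ x : MemberY θ.d₆ θ.ℓ₆ θ.hd' θ.hL' θ.b₀ θ.b₁ Mstar, 𝔭A x = holderProbesKA x.toKIdx (trBasis N) (bg9YR (Matrix (Fin N) (Fin N) ℂ) (specialUnitaryUnits (Fin N)) R₁ R₂ x) (fun U => U) (parB x) (bI x))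
    (Dd Dsd : ∀ x : MemberY θ.d₆ θ.ℓ₆ θ.hd' θ.hL' θ.b₀ θ.b₁ Mstar, (bg9YR (Matrix (Fin N) (Fin N) ℂ) (specialUnitaryUnits (Fin N)) R₁ R₂ x).Cfg → Fin (θ.d₆ + 1) → Module.End ℝ (XBK (TrIdx N) x.toKIdx → ℝ))
    (hDd : ∀ (x : MemberY θ.d₆ θ.ℓ₆ θ.hd' θ.hL' θ.b₀ θ.b₁ Mstar) (U : (bg9YR (Matrix (Fin N) (Fin N) ℂ) (specialUnitaryUnits (Fin N)) R₁ R₂ x).Cfg), Dd x U = fun ν => coordOpK (trBasis N) (fun _ : Fin (θ.d₆ + 1) => cdBₗ x.toKIdx U ν))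
    {Gp : ∀ x : MemberY θ.d₆ θ.ℓ₆ θ.hd' θ.hL' θ.b₀ θ.b₁ Mstar, SiteOpY (Matrix (Fin N) (Fin N) ℂ) x.toKIdx}
    (hGp : ∀ x : MemberY θ.d₆ θ.ℓ₆ θ.hd' θ.hL' θ.b₀ θ.b₁ Mstar, Gp x = GpY x.toKIdx (parSymY x.toKIdx))
    {parS : ∀ x : MemberY θ.d₆ θ.ℓ₆ θ.hd' θ.hL' θ.b₀ θ.b₁ Mstar, SiteParY (Matrix (Fin N) (Fin N) ℂ) x.toKIdx}
    (hparS : ∀ x : MemberY θ.d₆ θ.ℓ₆ θ.hd' θ.hL' θ.b₀ θ.b₁ Mstar, parS x = parSymY x.toKIdx)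
    -- letters of the input facts (implicit, read off the facts) and the two target rates
    {B₀ δ₀ CP δ49 tJ δB B43 δ43 tA δT δ₂ B44 δ44 B12₃ δ12₃ Bx13₀ B12₀ δ12₀ B₀G δ₀G BHG B₃ δ₃ δK δP CW : ℝ} {Bx13 Bh12 Bi BhG Bd BhD BdX : ℝ → ℝ}
    (hB₀ : 0 ≤ B₀) (hCP : 0 ≤ CP) (htJ : 0 ≤ tJ) (hB43 : 0 ≤ B43) (htA : 0 ≤ tA) (hB44 : 0 ≤ B44) (hB12₃ : 0 ≤ B12₃) (hBx13 : ∀ β, 0 ≤ β → β < 1 → 0 ≤ Bx13 β) (hBx13₀ : 0 ≤ Bx13₀)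
    (hwBx13 : ∀ s, 0 < s → s < 1 → wX s * Bx13 s ≤ Bx13₀) (hB12₀ : 0 ≤ B12₀) (hBh12 : ∀ β, 0 ≤ β → β < 1 → 0 ≤ Bh12 β) (hBi : ∀ ε, 0 < ε → ε ≤ 1 → 0 ≤ Bi ε) (hB₀G : 0 ≤ B₀G) (hBhG : ∀ s, 0 < s → s < 1 → 0 ≤ BhG s)
    (hBHG : 0 ≤ BHG) (hwBhG : ∀ s, 0 < s → s < 1 → wX s * BhG s ≤ BHG) (hBd : ∀ ε, 0 < ε → 0 ≤ Bd ε) (hCW : 0 ≤ CW) (hB₃ : 0 ≤ B₃) (hBhD : ∀ β, 0 ≤ β → β < 1 → 0 ≤ BhD β) (hBdX : ∀ β, 0 ≤ β → β < 1 → 0 ≤ BdX β)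
    -- the rate budget: the step∕pair rate δK and the producer∕reading rate δP against the input rates (σ = the row-sum margin, τ = the (Lʲη)-weight loss)
    (hδK : 0 ≤ δK) (hr0 : δK + 3 * σ + 4 * τ ≤ δ₀) (hr49 : δK + 3 * σ + 4 * τ ≤ δ49) (hr2 : δK + 3 * σ + 4 * τ ≤ δ₂) (hr44 : δK + 3 * σ + 5 * τ ≤ δ44) (hrB : δK + 3 * σ + 4 * τ ≤ δB)
    (hr43 : δK + 2 * σ + τ ≤ δ43) (hrT : δK + τ + σ ≤ δT) (hK3d : δK + τ + σ ≤ δ₃) (hKP : δK + τ + σ ≤ δP)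
    (hP0 : δP + 2 * τ ≤ δ12₀) (hP3 : δP + σ + 2 * τ ≤ δ12₃) (hPG : δP + τ ≤ δ₀G)
    -- the input facts (all displayed hypotheses of the certificate of record or outputs of its G₀ layer), member-uniform above (M₀, a₀)
    (h31 : ∀ x : MemberY θ.d₆ θ.ℓ₆ θ.hd' θ.hL' θ.b₀ θ.b₁ Mstar, M₀ ≤ (geo9Y x).M → ∀ α₀ : ℝ, 0 < α₀ → (geo9Y x).M * α₀ ≤ a₀ → ∀ U : (bg9YR (Matrix (Fin N) (Fin N) ℂ) (specialUnitaryUnits (Fin N)) R₁ R₂ x).Cfg, (bg9YR (Matrix (Fin N) (Fin N) ℂ) (specialUnitaryUnits (Fin N)) R₁ R₂ x).Reg335 c α₀ U →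
      Thm31GpMaj (g := geo9Y x) (blkSK x.toKIdx (sIK x.toKIdx (bI x))) (blkBK x.toKIdx (bI x))
        (GcoS x.toKIdx (trBasis N) (bg9YR (Matrix (Fin N) (Fin N) ℂ) (specialUnitaryUnits (Fin N)) R₁ R₂ x) (fun U => U) (Gp x) U)
        (DvcoKH x.toKIdx (trBasis N) (bg9YR (Matrix (Fin N) (Fin N) ℂ) (specialUnitaryUnits (Fin N)) R₁ R₂ x) (fun U => U) U) (DvscoKH x.toKIdx (trBasis N) (bg9YR (Matrix (Fin N) (Fin N) ℂ) (specialUnitaryUnits (Fin N)) R₁ R₂ x) (fun U => U) U) 1 (H x) B₀ δ₀)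
    (h49 : ∀ x : MemberY θ.d₆ θ.ℓ₆ θ.hd' θ.hL' θ.b₀ θ.b₁ Mstar, M₀ ≤ (geo9Y x).M → ∀ α₀ : ℝ, 0 < α₀ → (geo9Y x).M * α₀ ≤ a₀ → ∀ U : (bg9YR (Matrix (Fin N) (Fin N) ℂ) (specialUnitaryUnits (Fin N)) R₁ R₂ x).Cfg, (bg9YR (Matrix (Fin N) (Fin N) ℂ) (specialUnitaryUnits (Fin N)) R₁ R₂ x).Reg335 c α₀ U →
      Proj349Maj (g := geo9Y x) (blkSK x.toKIdx (sIK x.toKIdx (bI x))) (blkBK x.toKIdx (bI x))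
        (PcoK x.toKIdx (trBasis N) (bg9YR (Matrix (Fin N) (Fin N) ℂ) (specialUnitaryUnits (Fin N)) R₁ R₂ x) (fun U => U) (parS x) (Gp x) U)
        (DvcoKH x.toKIdx (trBasis N) (bg9YR (Matrix (Fin N) (Fin N) ℂ) (specialUnitaryUnits (Fin N)) R₁ R₂ x) (fun U => U) U) (DvscoKH x.toKIdx (trBasis N) (bg9YR (Matrix (Fin N) (Fin N) ℂ) (specialUnitaryUnits (Fin N)) R₁ R₂ x) (fun U => U) U) 1 (H x) CP δ49)
    (h43 : ∀ x : MemberY θ.d₆ θ.ℓ₆ θ.hd' θ.hL' θ.b₀ θ.b₁ Mstar, letI : Fintype (geo9K x.toKIdx).Site := (inferInstance : Fintype (geo9Y x).Site); M₀ ≤ (geo9Y x).M → ∀ α₀ : ℝ, 0 < α₀ → (geo9Y x).M * α₀ ≤ a₀ → ∀ U : (bg9YR (Matrix (Fin N) (Fin N) ℂ) (specialUnitaryUnits (Fin N)) R₁ R₂ x).Cfg, (bg9YR (Matrix (Fin N) (Fin N) ℂ) (specialUnitaryUnits (Fin N)) R₁ R₂ x).Reg335 c α₀ U →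
      (bg9YR (Matrix (Fin N) (Fin N) ℂ) (specialUnitaryUnits (Fin N)) R₁ R₂ x).Reg336 c α₀ U →
        HasMaj (cNorm 1 (H x) (𝔬12 x).blk (fun y => (geo9Y_len_pos x y).le) 0) (bH13 x U)
          (GcoS x.toKIdx (trBasis N) (bg9YR (Matrix (Fin N) (Fin N) ℂ) (specialUnitaryUnits (Fin N)) R₁ R₂ x) (fun U => U) (GpY x.toKIdx (parSymY x.toKIdx)) U ∘ₗ DvscoKH x.toKIdx (trBasis N) (bg9YR (Matrix (Fin N) (Fin N) ℂ) (specialUnitaryUnits (Fin N)) R₁ R₂ x) (fun U => U) U)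
          (fun a a' => B43 * Real.exp (-(δ43 * (geo9Y x).dist a a'))))
    (h44G : ∀ x : MemberY θ.d₆ θ.ℓ₆ θ.hd' θ.hL' θ.b₀ θ.b₁ Mstar, letI : Fintype (geo9K x.toKIdx).Site := (inferInstance : Fintype (geo9Y x).Site); M₀ ≤ (geo9Y x).M → ∀ α₀ : ℝ, 0 < α₀ → (geo9Y x).M * α₀ ≤ a₀ → ∀ U : (bg9YR (Matrix (Fin N) (Fin N) ℂ) (specialUnitaryUnits (Fin N)) R₁ R₂ x).Cfg, (bg9YR (Matrix (Fin N) (Fin N) ℂ) (specialUnitaryUnits (Fin N)) R₁ R₂ x).Reg335 c α₀ U → (bg9YR (Matrix (Fin N) (Fin N) ℂ) (specialUnitaryUnits (Fin N)) R₁ R₂ x).Reg336 c α₀ U →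
      HasMaj (bHZKP (κ := TrIdx N) x.toKIdx (trBasis N) (taxiB x.toKIdx (bg9YR (Matrix (Fin N) (Fin N) ℂ) (specialUnitaryUnits (Fin N)) R₁ R₂ x) (fun U => U) U) (R := (1 : ℝ)) (H := H x) hs440.le hs441.le) (cNorm 1 (H x) (𝔬12 x).blk (fun y => (geo9Y_len_pos x y).le) 1)
        ((𝔬12 x).Dv U ∘ₗ GcoS x.toKIdx (trBasis N) (bg9YR (Matrix (Fin N) (Fin N) ℂ) (specialUnitaryUnits (Fin N)) R₁ R₂ x) (fun U => U) (GpY x.toKIdx (parSymY x.toKIdx)) U ∘ₗ (𝔬12 x).Dvstar U) (fun a b => B44 * Real.exp (-(δ44 * (geo9Y x).dist a b))))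
    (hta : ∀ x : MemberY θ.d₆ θ.ℓ₆ θ.hd' θ.hL' θ.b₀ θ.b₁ Mstar, M₀ ≤ (geo9Y x).M → ∀ α₀ : ℝ, 0 < α₀ → (geo9Y x).M * α₀ ≤ a₀ → ∀ U : (bg9YR (Matrix (Fin N) (Fin N) ℂ) (specialUnitaryUnits (Fin N)) R₁ R₂ x).Cfg, (bg9YR (Matrix (Fin N) (Fin N) ℂ) (specialUnitaryUnits (Fin N)) R₁ R₂ x).Reg335 c α₀ U →
      (bg9YR (Matrix (Fin N) (Fin N) ℂ) (specialUnitaryUnits (Fin N)) R₁ R₂ x).Reg336 c α₀ U → HasMaj (cNorm 1 (H x) (𝔬12 x).blk (fun y => (geo9Y_len_pos x y).le) 2) (cNorm 1 (H x) (𝔬12 x).blk (fun y => (geo9Y_len_pos x y).le) 0) (TaLcoK x.toKIdx (trBasis N) (bg9YR (Matrix (Fin N) (Fin N) ℂ) (specialUnitaryUnits (Fin N)) R₁ R₂ x) (fun U => U) (parSymY x.toKIdx) (GpPhysY x.toKIdx (parSymY x.toKIdx)) U) (fun a a' => tA * ((geo9Y x).M * α₀) * Real.exp (-(δT * (geo9Y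 x).dist a a'))))
    (hBJ : ∀ x : MemberY θ.d₆ θ.ℓ₆ θ.hd' θ.hL' θ.b₀ θ.b₁ Mstar, M₀ ≤ (geo9Y x).M → ∀ α₀ : ℝ, 0 < α₀ → (geo9Y x).M * α₀ ≤ a₀ → ∀ U : (bg9YR (Matrix (Fin N) (Fin N) ℂ) (specialUnitaryUnits (Fin N)) R₁ R₂ x).Cfg, (bg9YR (Matrix (Fin N) (Fin N) ℂ) (specialUnitaryUnits (Fin N)) R₁ R₂ x).Reg335 c α₀ U →
      (bg9YR (Matrix (Fin N) (Fin N) ℂ) (specialUnitaryUnits (Fin N)) R₁ R₂ x).Reg336 c α₀ U → CurrentMaj (𝔬12 x).blkW (𝔬12 x).blk (BcoKH x.toKIdx (trBasis N) (bg9YR (Matrix (Fin N) (Fin N) ℂ) (specialUnitaryUnits (Fin N)) R₁ R₂ x) (fun U => U) U)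
        (BdcoKH x.toKIdx (trBasis N) (bg9YR (Matrix (Fin N) (Fin N) ℂ) (specialUnitaryUnits (Fin N)) R₁ R₂ x) (fun U => U) U) 1 (H x) (tJ * ((geo9Y x).M * α₀)) δB)
    (hZ81 : ∀ x : MemberY θ.d₆ θ.ℓ₆ θ.hd' θ.hL' θ.b₀ θ.b₁ Mstar, M₀ ≤ (geo9Y x).M → ∀ α₀ : ℝ, 0 < α₀ → (geo9Y x).M * α₀ ≤ a₀ → ∀ U : (bg9YR (Matrix (Fin N) (Fin N) ℂ) (specialUnitaryUnits (Fin N)) R₁ R₂ x).Cfg, (bg9YR (Matrix (Fin N) (Fin N) ℂ) (specialUnitaryUnits (Fin N)) R₁ R₂ x).Reg335 c α₀ U → (bg9YR (Matrix (Fin N) (Fin N) ℂ) (specialUnitaryUnits (Fin N)) R₁ R₂ x).Reg336 c α₀ U →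
      HasMaj (cNorm 1 (H x) (𝔬12 x).blkW (fun y => (geo9Y_len_pos x y).le) 1) (cNorm 1 (H x) (𝔬12 x).blk (fun y => (geo9Y_len_pos x y).le) 2) ((𝔬12 x).G0 U ∘ₗ (𝔬12 x).Dv U)
        (fun a b => B12₃ * Real.exp (-(δ12₃ * (geo9Y x).dist a b))))
    (hpXDv : ∀ x : MemberY θ.d₆ θ.ℓ₆ θ.hd' θ.hL' θ.b₀ θ.b₁ Mstar, M₀ ≤ (geo9Y x).M → ∀ α₀ : ℝ, 0 < α₀ → (geo9Y x).M * α₀ ≤ a₀ → ∀ U : (bg9YR (Matrix (Fin N) (Fin N) ℂ) (specialUnitaryUnits (Fin N)) R₁ R₂ x).Cfg, (bg9YR (Matrix (Fin N) (Fin N) ℂ) (specialUnitaryUnits (Fin N)) R₁ R₂ x).Reg335 c α₀ U → (bg9YR (Matrix (Fin N) (Fin N) ℂ) (specialUnitaryUnits (Fin N)) R₁ R₂ x).Reg336 c α₀ U → ∀ β : ℝ, 0 ≤ β → β < 1 →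
      HasMaj (cNormR 1 (H x) (𝔬12 x).blkW (fun y => (geo9Y_len_pos x y).le) 0) (cNormR 1 (H x) (𝔭A x).blkPX (fun y => (geo9Y_len_pos x y).le) (β - 1))
        (((𝔭A x).ΦX U β ∘ₗ (𝔬12 x).G0 U) ∘ₗ (𝔬12 x).Dv U) (fun a b => Bx13 β * Real.exp (-(δ12₃ * (geo9Y x).dist a b))))
    (he0 : ∀ x : MemberY θ.d₆ θ.ℓ₆ θ.hd' θ.hL' θ.b₀ θ.b₁ Mstar, M₀ ≤ (geo9Y x).M → ∀ α₀ : ℝ, 0 < α₀ → (geo9Y x).M * α₀ ≤ a₀ → ∀ U : (bg9YR (Matrix (Fin N) (Fin N) ℂ) (specialUnitaryUnits (Fin N)) R₁ R₂ x).Cfg, (bg9YR (Matrix (Fin N) (Fin N) ℂ) (specialUnitaryUnits (Fin N)) R₁ R₂ x).Reg335 c α₀ U → (bg9YR (Matrix (Fin N) (Fin N) ℂ) (specialUnitaryUnits (Fin N)) R₁ R₂ x).Reg336 c α₀ U →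
      HasMajorant (g := toB6 (geo9Y x) 1 (H x)) (𝔬12 x).blk ((𝔬12 x).G0 U) (fun (a b : (geo9Y x).Site) => B12₀ * (geo9Y x).len a ^ 2 * Real.exp (-(δ12₀ * (geo9Y x).dist a b))))
    (he1d : ∀ x : MemberY θ.d₆ θ.ℓ₆ θ.hd' θ.hL' θ.b₀ θ.b₁ Mstar, M₀ ≤ (geo9Y x).M → ∀ α₀ : ℝ, 0 < α₀ → (geo9Y x).M * α₀ ≤ a₀ → ∀ U : (bg9YR (Matrix (Fin N) (Fin N) ℂ) (specialUnitaryUnits (Fin N)) R₁ R₂ x).Cfg, (bg9YR (Matrix (Fin N) (Fin N) ℂ) (specialUnitaryUnits (Fin N)) R₁ R₂ x).Reg335 c α₀ U → (bg9YR (Matrix (Fin N) (Fin N) ℂ) (specialUnitaryUnits (Fin N)) R₁ R₂ x).Reg336 c α₀ U → ∀ μ : Fin (θ.d₆ + 1),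
      HasMajorantHom (g := toB6 (geo9Y x) 1 (H x)) (𝔬12 x).blk (𝔬12 x).blk (Dd x U μ ∘ₗ (𝔬12 x).G0 U)
        (fun (a b : (geo9Y x).Site) => B12₀ * (geo9Y x).len a * Real.exp (-(δ12₀ * (geo9Y x).dist a b))))
    (he2 : ∀ x : MemberY θ.d₆ θ.ℓ₆ θ.hd' θ.hL' θ.b₀ θ.b₁ Mstar, M₀ ≤ (geo9Y x).M → ∀ α₀ : ℝ, 0 < α₀ → (geo9Y x).M * α₀ ≤ a₀ → ∀ U : (bg9YR (Matrix (Fin N) (Fin N) ℂ) (specialUnitaryUnits (Fin N)) R₁ R₂ x).Cfg, (bg9YR (Matrix (Fin N) (Fin N) ℂ) (specialUnitaryUnits (Fin N)) R₁ R₂ x).Reg335 c α₀ U → (bg9YR (Matrix (Fin N) (Fin N) ℂ) (specialUnitaryUnits (Fin N)) R₁ R₂ x).Reg336 c α₀ U →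
      HasMajorantHom (g := toB6 (geo9Y x) 1 (H x)) (𝔬12 x).blkY (𝔬12 x).blk ((𝔬12 x).G0 U ∘ₗ (𝔬12 x).Dstar U) (fun a b => B₀G * (geo9Y x).len a * Real.exp (-(δ₀G * (geo9Y x).dist a b))))
    (h43RG : ∀ x : MemberY θ.d₆ θ.ℓ₆ θ.hd' θ.hL' θ.b₀ θ.b₁ Mstar, M₀ ≤ (geo9Y x).M → ∀ α₀ : ℝ, 0 < α₀ → (geo9Y x).M * α₀ ≤ a₀ → ∀ U : (bg9YR (Matrix (Fin N) (Fin N) ℂ) (specialUnitaryUnits (Fin N)) R₁ R₂ x).Cfg, (bg9YR (Matrix (Fin N) (Fin N) ℂ) (specialUnitaryUnits (Fin N)) R₁ R₂ x).Reg335 c α₀ U → (bg9YR (Matrix (Fin N) (Fin N) ℂ) (specialUnitaryUnits (Fin N)) R₁ R₂ x).Reg336 c α₀ U →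
      ∀ s' : ℝ, 0 < s' → s' < 1 → HasMajorantHom (g := toB6 (geo9Y x) 1 (H x)) (𝔬12 x).blkY (𝔭A x).blkPX ((𝔭A x).ΦX U s' ∘ₗ ((𝔬12 x).G0 U ∘ₗ (𝔬12 x).Dstar U)) (fun (a b : (geo9Y x).Site) => BhG s' * (geo9Y x).len a ^ (1 - s') * Real.exp (-(δ₀G * (geo9Y x).dist a b))))
    (hgQs1 : ∀ x : MemberY θ.d₆ θ.ℓ₆ θ.hd' θ.hL' θ.b₀ θ.b₁ Mstar, M₀ ≤ (geo9Y x).M → ∀ α₀ : ℝ, 0 < α₀ → (geo9Y x).M * α₀ ≤ a₀ → ∀ U : (bg9YR (Matrix (Fin N) (Fin N) ℂ) (specialUnitaryUnits (Fin N)) R₁ R₂ x).Cfg, (bg9YR (Matrix (Fin N) (Fin N) ℂ) (specialUnitaryUnits (Fin N)) R₁ R₂ x).Reg335 c α₀ U → (bg9YR (Matrix (Fin N) (Fin N) ℂ) (specialUnitaryUnits (Fin N)) R₁ R₂ x).Reg336 c α₀ U →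
      HasMaj (weightNorm (BlockNorm.ofBlocks (toB6 (geo9Y x) 1 (H x)) (𝔬12 x).blkZ) (fun y => (geo9Y x).len y * (fun y => ((((θ.ℓ₆ + 1 : ℕ) : ℝ) ^ (θ.d₆ + 1)) ^ lvl x.hN x.D x.hk y)⁻¹) y) (fun y => (mul_pos (geo9Y_len_pos x y) (plateau_pos x.toKIdx y)).le)) (cNorm 1 (H x) (𝔬12 x).blk (fun y => (geo9Y_len_pos x y).le) 1) ((𝔬12 x).G0 U ∘ₗ (𝔬12 x).Qstar U) (fun a b => B12₃ * Real.exp (-(δ12₃ * (geo9Y x).dist a b))))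
    (hpXQs : ∀ x : MemberY θ.d₆ θ.ℓ₆ θ.hd' θ.hL' θ.b₀ θ.b₁ Mstar, M₀ ≤ (geo9Y x).M → ∀ α₀ : ℝ, 0 < α₀ → (geo9Y x).M * α₀ ≤ a₀ → ∀ U : (bg9YR (Matrix (Fin N) (Fin N) ℂ) (specialUnitaryUnits (Fin N)) R₁ R₂ x).Cfg, (bg9YR (Matrix (Fin N) (Fin N) ℂ) (specialUnitaryUnits (Fin N)) R₁ R₂ x).Reg335 c α₀ U → (bg9YR (Matrix (Fin N) (Fin N) ℂ) (specialUnitaryUnits (Fin N)) R₁ R₂ x).Reg336 c α₀ U → ∀ β : ℝ, 0 ≤ β → β < 1 →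
      HasMaj (weightNorm (BlockNorm.ofBlocks (toB6 (geo9Y x) 1 (H x)) (𝔬12 x).blkZ) (fun y => (geo9Y x).len y * (fun y => ((((θ.ℓ₆ + 1 : ℕ) : ℝ) ^ (θ.d₆ + 1)) ^ lvl x.hN x.D x.hk y)⁻¹) y) (fun y => (mul_pos (geo9Y_len_pos x y) (plateau_pos x.toKIdx y)).le)) (cNormR 1 (H x) (𝔭A x).blkPX (fun y => (geo9Y_len_pos x y).le) (β - 1)) (((𝔭A x).ΦX U β ∘ₗ (𝔬12 x).G0 U) ∘ₗ (𝔬12 x).Qstar U) (fun a b => Bx13 β * Real.exp (-(δ12₃ * (geo9Y x).dist a b))))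
    (hDirR : ∀ x : MemberY θ.d₆ θ.ℓ₆ θ.hd' θ.hL' θ.b₀ θ.b₁ Mstar, M₀ ≤ (geo9Y x).M → ∀ α₀ : ℝ, 0 < α₀ → (geo9Y x).M * α₀ ≤ a₀ → ∀ U : (bg9YR (Matrix (Fin N) (Fin N) ℂ) (specialUnitaryUnits (Fin N)) R₁ R₂ x).Cfg, (bg9YR (Matrix (Fin N) (Fin N) ℂ) (specialUnitaryUnits (Fin N)) R₁ R₂ x).Reg335 c α₀ U → (bg9YR (Matrix (Fin N) (Fin N) ℂ) (specialUnitaryUnits (Fin N)) R₁ R₂ x).Reg336 c α₀ U →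
      Thm33G0DirR (𝔬12 x) (Dsd x) 1 (H x) B12₀ δ12₀ U)
    (hDir : ∀ x : MemberY θ.d₆ θ.ℓ₆ θ.hd' θ.hL' θ.b₀ θ.b₁ Mstar, M₀ ≤ (geo9Y x).M → ∀ α₀ : ℝ, 0 < α₀ → (geo9Y x).M * α₀ ≤ a₀ → ∀ U : (bg9YR (Matrix (Fin N) (Fin N) ℂ) (specialUnitaryUnits (Fin N)) R₁ R₂ x).Cfg, (bg9YR (Matrix (Fin N) (Fin N) ℂ) (specialUnitaryUnits (Fin N)) R₁ R₂ x).Reg335 c α₀ U → (bg9YR (Matrix (Fin N) (Fin N) ℂ) (specialUnitaryUnits (Fin N)) R₁ R₂ x).Reg336 c α₀ U →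
      ∀ (q : Fin (θ.d₆ + 1) × Fin (θ.d₆ + 1)) (ε : ℝ), 0 < ε → ε ≤ 1 → HasMaj (bHXA x ε) (BlockNorm.ofBlocks (toB6 (geo9Y x) 1 (H x)) (𝔬12 x).blk) (Dd x U q.1 ∘ₗ ((𝔬12 x).G0 U ∘ₗ Dsd x U q.2))
        (fun (a b : (geo9Y x).Site) => Bi ε * Real.exp (-(δ12₀ * (geo9Y x).dist a b))))
    (hdgDvd : ∀ x : MemberY θ.d₆ θ.ℓ₆ θ.hd' θ.hL' θ.b₀ θ.b₁ Mstar, M₀ ≤ (geo9Y x).M → ∀ α₀ : ℝ, 0 < α₀ → (geo9Y x).M * α₀ ≤ a₀ → ∀ U : (bg9YR (Matrix (Fin N) (Fin N) ℂ) (specialUnitaryUnits (Fin N)) R₁ R₂ x).Cfg, (bg9YR (Matrix (Fin N) (Fin N) ℂ) (specialUnitaryUnits (Fin N)) R₁ R₂ x).Reg335 c α₀ U → (bg9YR (Matrix (Fin N) (Fin N) ℂ) (specialUnitaryUnits (Fin N)) R₁ R₂ x).Reg336 c α₀ U →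
      ∀ (ν : Fin (θ.d₆ + 1)) (ε : ℝ), 0 < ε →
        HasMaj (bW x U ε) (BlockNorm.ofBlocks (toB6 (geo9Y x) 1 (H x)) (𝔬12 x).blk) (Dd x U ν ∘ₗ ((𝔬12 x).G0 U ∘ₗ (𝔬12 x).Dv U)) (fun (a b : (geo9Y x).Site) => Bd ε * Real.exp (-(δ12₃ * (geo9Y x).dist a b))))
    -- (variant `W`) the site class DOMINATES the block-sup class of the site fields: the source transfer of the z-letters' sup word into `bW x U ε` (class lemma, displayed)
    (htransW : ∀ x : MemberY θ.d₆ θ.ℓ₆ θ.hd' θ.hL' θ.b₀ θ.b₁ Mstar, M₀ ≤ (geo9Y x).M → ∀ (U : (bg9YR (Matrix (Fin N) (Fin N) ℂ) (specialUnitaryUnits (Fin N)) R₁ R₂ x).Cfg) (ε : ℝ), 0 < ε → ∀ K : ℝ, 0 ≤ K → HasMaj (BlockNorm.ofBlocks (toB6 (geo9Y x) 1 (H x)) (blkSK x.toKIdx (sIK x.toKIdx (bI x)))) (cNormR 1 (H x) (blkBK x.toKIdx (bI x)) (fun y => (geo9Y_len_pos x y).le) (-1)) ((𝔬12 x).G0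 U ∘ₗ (𝔬12 x).Dv U) (fun a b => K * Real.exp (-((δ12₃ - τ) * (geo9Y x).dist a b))) →
      HasMaj (bW x U ε) (cNormR 1 (H x) (blkBK x.toKIdx (bI x)) (fun y => (geo9Y_len_pos x y).le) (-1)) ((𝔬12 x).G0 U ∘ₗ (𝔬12 x).Dv U) (fun a b => CW * K * Real.exp (-((δ12₃ - τ) * (geo9Y x).dist a b))))
    (he1 : ∀ x : MemberY θ.d₆ θ.ℓ₆ θ.hd' θ.hL' θ.b₀ θ.b₁ Mstar, M₀ ≤ (geo9Y x).M → ∀ α₀ : ℝ, 0 < α₀ → (geo9Y x).M * α₀ ≤ a₀ → ∀ U : (bg9YR (Matrix (Fin N) (Fin N) ℂ) (specialUnitaryUnits (Fin N)) R₁ R₂ x).Cfg, (bg9YR (Matrix (Fin N) (Fin N) ℂ) (specialUnitaryUnits (Fin N)) R₁ R₂ x).Reg335 c α₀ U → (bg9YR (Matrix (Fin N) (Fin N) ℂ) (specialUnitaryUnits (Fin N)) R₁ R₂ x).Reg336 c α₀ U →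
      HasMajorantHom (g := toB6 (geo9Y x) 1 (H x)) (𝔬12 x).blk (𝔬12 x).blkY ((𝔬12 x).D U ∘ₗ (𝔬12 x).G0 U) (fun (a b : (geo9Y x).Site) => B12₀ * (geo9Y x).len a * Real.exp (-(δ12₀ * (geo9Y x).dist a b))))
    (h43L : ∀ x : MemberY θ.d₆ θ.ℓ₆ θ.hd' θ.hL' θ.b₀ θ.b₁ Mstar, M₀ ≤ (geo9Y x).M → ∀ α₀ : ℝ, 0 < α₀ → (geo9Y x).M * α₀ ≤ a₀ → ∀ U : (bg9YR (Matrix (Fin N) (Fin N) ℂ) (specialUnitaryUnits (Fin N)) R₁ R₂ x).Cfg, (bg9YR (Matrix (Fin N) (Fin N) ℂ) (specialUnitaryUnits (Fin N)) R₁ R₂ x).Reg335 c α₀ U → (bg9YR (Matrix (Fin N) (Fin N) ℂ) (specialUnitaryUnits (Fin N)) R₁ R₂ x).Reg336 c α₀ U → ∀ β : ℝ, 0 ≤ β → β < 1 →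
      HasMajorantHom (g := toB6 (geo9Y x) 1 (H x)) (𝔬12 x).blk (𝔭A x).blkPY ((𝔭A x).ΦY U β ∘ₗ ((𝔬12 x).D U ∘ₗ (𝔬12 x).G0 U)) (fun (a b : (geo9Y x).Site) => Bh12 β * (geo9Y x).len a ^ (1 - β) * Real.exp (-(δ12₀ * (geo9Y x).dist a b))))
    (h43d : ∀ x : MemberY θ.d₆ θ.ℓ₆ θ.hd' θ.hL' θ.b₀ θ.b₁ Mstar, M₀ ≤ (geo9Y x).M → ∀ α₀ : ℝ, 0 < α₀ → (geo9Y x).M * α₀ ≤ a₀ → ∀ U : (bg9YR (Matrix (Fin N) (Fin N) ℂ) (specialUnitaryUnits (Fin N)) R₁ R₂ x).Cfg, (bg9YR (Matrix (Fin N) (Fin N) ℂ) (specialUnitaryUnits (Fin N)) R₁ R₂ x).Reg335 c α₀ U → (bg9YR (Matrix (Fin N) (Fin N) ℂ) (specialUnitaryUnits (Fin N)) R₁ R₂ x).Reg336 c α₀ U → ∀ (ν : Fin (θ.d₆ + 1)) (β : ℝ), 0 ≤ β → β < 1 →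
      HasMajorantHom (g := toB6 (geo9Y x) 1 (H x)) (𝔬12 x).blk (𝔭A x).blkPX ((𝔭A x).ΦX U β ∘ₗ (Dd x U ν ∘ₗ (𝔬12 x).G0 U)) (fun (a b : (geo9Y x).Site) => Bh12 β * (geo9Y x).len a ^ (1 - β) * Real.exp (-(δ12₀ * (geo9Y x).dist a b))))
    (hdgDH : ∀ x : MemberY θ.d₆ θ.ℓ₆ θ.hd' θ.hL' θ.b₀ θ.b₁ Mstar, M₀ ≤ (geo9Y x).M → ∀ α₀ : ℝ, 0 < α₀ → (geo9Y x).M * α₀ ≤ a₀ → ∀ U : (bg9YR (Matrix (Fin N) (Fin N) ℂ) (specialUnitaryUnits (Fin N)) R₁ R₂ x).Cfg, (bg9YR (Matrix (Fin N) (Fin N) ℂ) (specialUnitaryUnits (Fin N)) R₁ R₂ x).Reg335 c α₀ U → (bg9YR (Matrix (Fin N) (Fin N) ℂ) (specialUnitaryUnits (Fin N)) R₁ R₂ x).Reg336 c α₀ U →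
      HasMaj (bH13 x U) (cNorm 1 (H x) (𝔬12 x).blkY (fun y => (geo9Y_len_pos x y).le) 1) ((𝔬12 x).D U ∘ₗ (𝔬12 x).G0 U ∘ₗ (𝔬12 x).Dv U) (fun a a' => B₃ * Real.exp (-(δ₃ * (geo9Y x).dist a a'))))
    (hdgDHd : ∀ x : MemberY θ.d₆ θ.ℓ₆ θ.hd' θ.hL' θ.b₀ θ.b₁ Mstar, M₀ ≤ (geo9Y x).M → ∀ α₀ : ℝ, 0 < α₀ → (geo9Y x).M * α₀ ≤ a₀ → ∀ U : (bg9YR (Matrix (Fin N) (Fin N) ℂ) (specialUnitaryUnits (Fin N)) R₁ R₂ x).Cfg, (bg9YR (Matrix (Fin N) (Fin N) ℂ) (specialUnitaryUnits (Fin N)) R₁ R₂ x).Reg335 c α₀ U → (bg9YR (Matrix (Fin N) (Fin N) ℂ) (specialUnitaryUnits (Fin N)) R₁ R₂ x).Reg336 c α₀ U → ∀ ν : Fin (θ.d₆ + 1),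
      HasMaj (bH13 x U) (cNorm 1 (H x) (𝔬12 x).blk (fun y => (geo9Y_len_pos x y).le) 1) (Dd x U ν ∘ₗ (𝔬12 x).G0 U ∘ₗ (𝔬12 x).Dv U) (fun a a' => B₃ * Real.exp (-(δ₃ * (geo9Y x).dist a a'))))
    (hYd : ∀ x : MemberY θ.d₆ θ.ℓ₆ θ.hd' θ.hL' θ.b₀ θ.b₁ Mstar, M₀ ≤ (geo9Y x).M → ∀ α₀ : ℝ, 0 < α₀ → (geo9Y x).M * α₀ ≤ a₀ → ∀ U : (bg9YR (Matrix (Fin N) (Fin N) ℂ) (specialUnitaryUnits (Fin N)) R₁ R₂ x).Cfg, (bg9YR (Matrix (Fin N) (Fin N) ℂ) (specialUnitaryUnits (Fin N)) R₁ R₂ x).Reg335 c α₀ U → (bg9YR (Matrix (Fin N) (Fin N) ℂ) (specialUnitaryUnits (Fin N)) R₁ R₂ x).Reg336 c α₀ U → ∀ β : ℝ, 0 ≤ β → β < 1 →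
      HasMaj (bH13 x U) (cNormR 1 (H x) (𝔭A x).blkPY (fun y => (geo9Y_len_pos x y).le) (β - 1)) (((𝔭A x).ΦY U β ∘ₗ (𝔬12 x).D U ∘ₗ (𝔬12 x).G0 U) ∘ₗ (𝔬12 x).Dv U) (fun a a' => BhD β * Real.exp (-(δ₃ * (geo9Y x).dist a a'))))
    (hXd : ∀ x : MemberY θ.d₆ θ.ℓ₆ θ.hd' θ.hL' θ.b₀ θ.b₁ Mstar, M₀ ≤ (geo9Y x).M → ∀ α₀ : ℝ, 0 < α₀ → (geo9Y x).M * α₀ ≤ a₀ → ∀ U : (bg9YR (Matrix (Fin N) (Fin N) ℂ) (specialUnitaryUnits (Fin N)) R₁ R₂ x).Cfg, (bg9YR (Matrix (Fin N) (Fin N) ℂ) (specialUnitaryUnits (Fin N)) R₁ R₂ x).Reg335 c α₀ U → (bg9YR (Matrix (Fin N) (Fin N) ℂ) (specialUnitaryUnits (Fin N)) R₁ R₂ x).Reg336 c α₀ U → ∀ (ν : Fin (θ.d₆ + 1)) (β : ℝ), 0 ≤ β → β < 1 →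
      HasMaj (bH13 x U) (cNormR 1 (H x) (𝔭A x).blkPX (fun y => (geo9Y_len_pos x y).le) (β - 1)) (((𝔭A x).ΦX U β ∘ₗ Dd x U ν ∘ₗ (𝔬12 x).G0 U) ∘ₗ (𝔬12 x).Dv U) (fun a a' => BdX β * Real.exp (-(δ₃ * (geo9Y x).dist a a'))))
    -- NEW (P-D2, cut B″): positivity of the regime letter; the Δ⁽²⁾-free resolvent data of the model — `G₀Δ_a = 1`, Δ_a > 0 in coordinates, G₀ symmetric, its L² block
    -- (the `l0` field of `Thm33G0L2M`), the T_π HALF of the certificate's L² step (n06-w8 `blockBd_tpi_of_letter_schemasR`) with its row-sum margin; the rate of G_D's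
    -- sup letter; the pins of S₀ ∕ G ∕ C ∕ Z; the class bridge; the (3.132) class letter of C; [5] (149) at print's weight
    (ha₀ : 0 < a₀)
    (hinvG0 : ∀ x : MemberY θ.d₆ θ.ℓ₆ θ.hd' θ.hL' θ.b₀ θ.b₁ Mstar, M₀ ≤ (geo9Y x).M → ∀ α₀ : ℝ, 0 < α₀ → (geo9Y x).M * α₀ ≤ a₀ → ∀ U : (bg9YR (Matrix (Fin N) (Fin N) ℂ) (specialUnitaryUnits (Fin N)) R₁ R₂ x).Cfg, (bg9YR (Matrix (Fin N) (Fin N) ℂ) (specialUnitaryUnits (Fin N)) R₁ R₂ x).Reg335 c α₀ U →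
      (bg9YR (Matrix (Fin N) (Fin N) ℂ) (specialUnitaryUnits (Fin N)) R₁ R₂ x).Reg336 c α₀ U → (𝔬12 x).G0 U * (𝔬12 x).S0 U = 1)
    (hpos12 : ∀ x : MemberY θ.d₆ θ.ℓ₆ θ.hd' θ.hL' θ.b₀ θ.b₁ Mstar, M₀ ≤ (geo9Y x).M → ∀ α₀ : ℝ, 0 < α₀ → (geo9Y x).M * α₀ ≤ a₀ → ∀ U : (bg9YR (Matrix (Fin N) (Fin N) ℂ) (specialUnitaryUnits (Fin N)) R₁ R₂ x).Cfg, (bg9YR (Matrix (Fin N) (Fin N) ℂ) (specialUnitaryUnits (Fin N)) R₁ R₂ x).Reg335 c α₀ U →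
      (bg9YR (Matrix (Fin N) (Fin N) ℂ) (specialUnitaryUnits (Fin N)) R₁ R₂ x).Reg336 c α₀ U → B9Thm312Whole.PosDefEnd ((𝔬12 x).S0 U))
    (hsym12 : ∀ x : MemberY θ.d₆ θ.ℓ₆ θ.hd' θ.hL' θ.b₀ θ.b₁ Mstar, M₀ ≤ (geo9Y x).M → ∀ α₀ : ℝ, 0 < α₀ → (geo9Y x).M * α₀ ≤ a₀ → ∀ U : (bg9YR (Matrix (Fin N) (Fin N) ℂ) (specialUnitaryUnits (Fin N)) R₁ R₂ x).Cfg, (bg9YR (Matrix (Fin N) (Fin N) ℂ) (specialUnitaryUnits (Fin N)) R₁ R₂ x).Reg335 c α₀ U →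
      (bg9YR (Matrix (Fin N) (Fin N) ℂ) (specialUnitaryUnits (Fin N)) R₁ R₂ x).Reg336 c α₀ U → B9Thm37Glue.IsTransposePair ((𝔬12 x).G0 U) ((𝔬12 x).G0 U))
    {BL0 δL0 t2L δT σF : ℝ} (hBL0 : 0 ≤ BL0) (ht2L : 0 ≤ t2L) (hσF : 0 < σF) (hσF0 : σF ≤ δL0) (hσFT : σF ≤ δT)
    (hl0 : ∀ x : MemberY θ.d₆ θ.ℓ₆ θ.hd' θ.hL' θ.b₀ θ.b₁ Mstar, M₀ ≤ (geo9Y x).M → ∀ α₀ : ℝ, 0 < α₀ → (geo9Y x).M * α₀ ≤ a₀ → ∀ U : (bg9YR (Matrix (Fin N) (Fin N) ℂ) (specialUnitaryUnits (Fin N)) R₁ R₂ x).Cfg, (bg9YR (Matrix (Fin N) (Fin N) ℂ) (specialUnitaryUnits (Fin N)) R₁ R₂ x).Reg335 c α₀ U →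
      (bg9YR (Matrix (Fin N) (Fin N) ℂ) (specialUnitaryUnits (Fin N)) R₁ R₂ x).Reg336 c α₀ U →
        B9SectDL2Decay.BlockBd (g := toB6 (geo9Y x) 1 (H x)) (𝔬12 x).blk (𝔬12 x).blk ((𝔬12 x).G0 U)
          (fun (y y' : (geo9Y x).Site) => BL0 * (geo9Y x).len y * (geo9Y x).len y' * Real.exp (-(δL0 * (geo9Y x).dist y y'))))
    (htpi : ∀ x : MemberY θ.d₆ θ.ℓ₆ θ.hd' θ.hL' θ.b₀ θ.b₁ Mstar, M₀ ≤ (geo9Y x).M → ∀ α₀ : ℝ, 0 < α₀ → (geo9Y x).M * α₀ ≤ a₀ → ∀ U : (bg9YR (Matrix (Fin N) (Fin N) ℂ) (specialUnitaryUnits (Fin N)) R₁ R₂ x).Cfg, (bg9YR (Matrix (Fin N) (Fin N) ℂ) (specialUnitaryUnits (Fin N)) R₁ R₂ x).Reg335 c α₀ U →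
      (bg9YR (Matrix (Fin N) (Fin N) ℂ) (specialUnitaryUnits (Fin N)) R₁ R₂ x).Reg336 c α₀ U →
        B9SectDL2Decay.BlockBd (g := toB6 (geo9Y x) 1 (H x)) (𝔬12 x).blk (𝔬12 x).blk ((𝔬12 x).Tpi U)
          (fun (y y' : (geo9Y x).Site) => t2L * ((geo9Y x).M * α₀) * ((geo9Y x).len y)⁻¹ * ((geo9Y x).len y')⁻¹ * Real.exp (-(δT * (geo9Y x).dist y y'))))
    {ρG : ℝ} (hρG : 0 < ρG) (hρGP : ρG + σ ≤ δP) (hρGK : ρG + 2 * σ ≤ δK)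
    (hS0co12 : ∀ (x : MemberY θ.d₆ θ.ℓ₆ θ.hd' θ.hL' θ.b₀ θ.b₁ Mstar) (U : (bg9YR (Matrix (Fin N) (Fin N) ℂ) (specialUnitaryUnits (Fin N)) R₁ R₂ x).Cfg),
      (𝔬12 x).S0 U = S0coK x.toKIdx (trBasis N) (bg9YR (Matrix (Fin N) (Fin N) ℂ) (specialUnitaryUnits (Fin N)) R₁ R₂ x) (fun U => U) (parSymY x.toKIdx) (parBY x.toKIdx) (GpPhysY x.toKIdx (parSymY x.toKIdx)) U)
    (hblkZ12 : ∀ x : MemberY θ.d₆ θ.ℓ₆ θ.hd' θ.hL' θ.b₀ θ.b₁ Mstar, (𝔬12 x).blkZ = blkHK x.toKIdx)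
    (hGco12 : ∀ (x : MemberY θ.d₆ θ.ℓ₆ θ.hd' θ.hL' θ.b₀ θ.b₁ Mstar) (U : (bg9YR (Matrix (Fin N) (Fin N) ℂ) (specialUnitaryUnits (Fin N)) R₁ R₂ x).Cfg),
      (𝔬12 x).G U = GcoK x.toKIdx (trBasis N) (bg9YR (Matrix (Fin N) (Fin N) ℂ) (specialUnitaryUnits (Fin N)) R₁ R₂ x) (fun U => U) (GDY x.toKIdx (parSymY x.toKIdx) (parBY x.toKIdx) (GpPhysY x.toKIdx (parSymY x.toKIdx))) U)
    (hCco12 : ∀ (x : MemberY θ.d₆ θ.ℓ₆ θ.hd' θ.hL' θ.b₀ θ.b₁ Mstar) (U : (bg9YR (Matrix (Fin N) (Fin N) ℂ) (specialUnitaryUnits (Fin N)) R₁ R₂ x).Cfg),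
      (𝔬12 x).C U = CcoK x.toKIdx (trBasis N) (bg9YR (Matrix (Fin N) (Fin N) ℂ) (specialUnitaryUnits (Fin N)) R₁ R₂ x) (fun U => U) (parSymY x.toKIdx) (parBY x.toKIdx) (GpPhysY x.toKIdx (parSymY x.toKIdx)) U)
    (hRP2 : ∀ (x : MemberY θ.d₆ θ.ℓ₆ θ.hd' θ.hL' θ.b₀ θ.b₁ Mstar) (α₀ : ℝ) (U : (bg9YR (Matrix (Fin N) (Fin N) ℂ) (specialUnitaryUnits (Fin N)) R₁ R₂ x).Cfg), (bg9YR (Matrix (Fin N) (Fin N) ℂ) (specialUnitaryUnits (Fin N)) R₁ R₂ x).Reg336 c α₀ U →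
      0 ≤ α₀ ∧ (bg9YP (Matrix (Fin N) (Fin N) ℂ) (specialUnitaryUnits (Fin N)) x).Reg336 c35Y α₀ U)
    {Bz δC κC δC2 : ℝ} (hBz : 0 ≤ Bz) (hδC : 0 < δC) (hκC : 0 ≤ κC) (hgap : δ₂ < δC2)
    (hc2 : ∀ x : MemberY θ.d₆ θ.ℓ₆ θ.hd' θ.hL' θ.b₀ θ.b₁ Mstar, M₀ ≤ (geo9Y x).M → ∀ α₀ : ℝ, 0 < α₀ → (geo9Y x).M * α₀ ≤ a₀ → ∀ U : (bg9YR (Matrix (Fin N) (Fin N) ℂ) (specialUnitaryUnits (Fin N)) R₁ R₂ x).Cfg, (bg9YR (Matrix (Fin N) (Fin N) ℂ) (specialUnitaryUnits (Fin N)) R₁ R₂ x).Reg335 c α₀ U →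
      (bg9YR (Matrix (Fin N) (Fin N) ℂ) (specialUnitaryUnits (Fin N)) R₁ R₂ x).Reg336 c α₀ U →
        HasMaj (cNorm 1 (H x) (𝔬12 x).blkZ (fun y => (geo9Y_len_pos x y).le) 2)
          (weightNorm (BlockNorm.ofBlocks (toB6 (geo9Y x) 1 (H x)) (𝔬12 x).blkZ) (fun y => ((((θ.ℓ₆ + 1 : ℕ) : ℝ) ^ (θ.d₆ + 1)) ^ lvl x.hN x.D x.hk y)⁻¹) (fun y => (plateau_pos x.toKIdx y).le))
          ((𝔬12 x).C U) (fun a b => Bz * Real.exp (-(δC * (geo9Y x).dist a b))))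
    (hC2 : ∀ x : MemberY θ.d₆ θ.ℓ₆ θ.hd' θ.hL' θ.b₀ θ.b₁ Mstar, M₀ ≤ (geo9Y x).M → ∀ α₀ : ℝ, 0 < α₀ → (geo9Y x).M * α₀ ≤ a₀ → ∀ U : (bg9YR (Matrix (Fin N) (Fin N) ℂ) (specialUnitaryUnits (Fin N)) R₁ R₂ x).Cfg, (bg9YR (Matrix (Fin N) (Fin N) ℂ) (specialUnitaryUnits (Fin N)) R₁ R₂ x).Reg335 c α₀ U →
      (bg9YR (Matrix (Fin N) (Fin N) ℂ) (specialUnitaryUnits (Fin N)) R₁ R₂ x).Reg336 c α₀ U →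
        C2FormMaj x.toKIdx (g := geo9Y x) (bI x) (fun c => c) (𝔠 x).form U κC δC2 (fun c => (geo9Y x).len c * (((((θ.ℓ₆ + 1 : ℕ) : ℝ) ^ (θ.d₆ + 1)) ^ lvl x.hN x.D x.hk c)⁻¹))) :
    ∃ MD aD θ₂ : ℝ, 0 < aD ∧ aD ≤ a₀ ∧ 0 ≤ θ₂ ∧
      ∀ x : MemberY θ.d₆ θ.ℓ₆ θ.hd' θ.hL' θ.b₀ θ.b₁ Mstar, MD ≤ (geo9Y x).M → ∀ α₀ : ℝ, 0 < α₀ → (geo9Y x).M * α₀ ≤ aD → ∀ U : (bg9YR (Matrix (Fin N) (Fin N) ℂ) (specialUnitaryUnits (Fin N)) R₁ R₂ x).Cfg, (bg9YR (Matrix (Fin N) (Fin N) ℂ) (specialUnitaryUnits (Fin N)) R₁ R₂ x).Reg335 c α₀ U →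
      (bg9YR (Matrix (Fin N) (Fin N) ℂ) (specialUnitaryUnits (Fin N)) R₁ R₂ x).Reg336 c α₀ U →
        HasMajorant (g := toB6 (geo9Y x) 1 (H x)) (𝔬12 x).blk (D2coK x.toKIdx (trBasis N) (bg9YR (Matrix (Fin N) (Fin N) ℂ) (specialUnitaryUnits (Fin N)) R₁ R₂ x) (fun U => U) (Δ2 x) U)
          (fun (a b : (geo9Y x).Site) => θ₂ * ((geo9Y x).M * α₀) * ((geo9Y x).len a ^ 2)⁻¹ * Real.exp (-(δ₂ * (geo9Y x).dist a b))) := by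
  have hN : 0 < N := Nat.pos_of_ne_zero (NeZero.ne N)
  have hcR : cR39 (trBasis N) ≠ 0 := (cR39_trBasis_pos hN).ne'
  have hδ₂ : 0 ≤ δ₂ := by linarith
  -- [4] (2.61) at the form-bound row-sum rate σF
  obtain ⟨MLσ, cσ, hrow0⟩ := rowSum261_geo9Y (d := θ.d₆) (ℓ := θ.ℓ₆) (hd := θ.hd') (hL := θ.hL') (b₀ := θ.b₀) (b₁ := θ.b₁) (Mstar := Mstar) σF hσF
  set c' : ℝ := max cσ 0 with hc'
  have hc'0 : 0 ≤ c' := le_max_right _ _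
  have hrow : ∀ x : MemberY θ.d₆ θ.ℓ₆ θ.hd' θ.hL' θ.b₀ θ.b₁ Mstar, MLσ ≤ (geo9Y x).M → RowSum (toB6 (geo9Y x) 1 (H x)) σF c' := fun x hM y => (hrow0 x hM y).trans (le_max_left _ _)
  -- the T_π form ratio and the produced regime of its smallness (print's Thm 3.11 + (3.122): r·Mα₀ < 1)
  set r₁ : ℝ := t2L * c' * (BL0 * c') with hr₁
  have hr₁nn : 0 ≤ r₁ := mul_nonneg (mul_nonneg ht2L hc'0) (mul_nonneg hBL0 hc'0)
  set aP : ℝ := min a₀ (1 / (2 * r₁ + 2)) with haPdef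
  have haP0 : 0 < aP := lt_min ha₀ (by positivity)
  have haPa : aP ≤ a₀ := min_le_left _ _
  -- the flat model of Δ⁽²⁾_π vanishes
  have hT2z : ∀ (x : MemberY θ.d₆ θ.ℓ₆ θ.hd' θ.hL' θ.b₀ θ.b₁ Mstar) (U : (bg9YR (Matrix (Fin N) (Fin N) ℂ) (specialUnitaryUnits (Fin N)) R₁ R₂ x).Cfg), T2coK x.toKIdx (trBasis N) (bg9YR (Matrix (Fin N) (Fin N) ℂ) (specialUnitaryUnits (Fin N)) R₁ R₂ x) (fun U => U) (parSymY x.toKIdx) (GpPhysY x.toKIdx (parSymY x.toKIdx)) (0 : BondOpY (Matrix (Fin N) (Fin N) ℂ) x.toKIdx) U = 0 := by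
    intro x U
    refine LinearMap.ext fun f => funext fun p => ?_
    show (cR39 (trBasis N))⁻¹ * (trBasis N).repr ((((delta2PiY x.toKIdx (parSymY x.toKIdx) (GpPhysY x.toKIdx (parSymY x.toKIdx)) (0 : BondOpY (Matrix (Fin N) (Fin N) ℂ) x.toKIdx) ((fun U => U) U))).restrictScalars ℝ)
      (B9CoReadingCoords.assembleK (trBasis N) p.2.1 p.2.2.2 f) p.1) p.2.2.1 = 0
    simp [delta2PiY]
  -- the Δ⁽²⁾-free resolvent identity (Δ_a − Δ′_π)·G = 1 from the T_π form bound, above max M₀ MLσ, in the regime aP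
  have hinvG : ∀ x : MemberY θ.d₆ θ.ℓ₆ θ.hd' θ.hL' θ.b₀ θ.b₁ Mstar, max M₀ MLσ ≤ (geo9Y x).M → ∀ α₀ : ℝ, 0 < α₀ → (geo9Y x).M * α₀ ≤ aP → ∀ U : (bg9YR (Matrix (Fin N) (Fin N) ℂ) (specialUnitaryUnits (Fin N)) R₁ R₂ x).Cfg, (bg9YR (Matrix (Fin N) (Fin N) ℂ) (specialUnitaryUnits (Fin N)) R₁ R₂ x).Reg335 c α₀ U →
      (bg9YR (Matrix (Fin N) (Fin N) ℂ) (specialUnitaryUnits (Fin N)) R₁ R₂ x).Reg336 c α₀ U → ((𝔬12 x).S0 U - (𝔬12 x).Tpi U) * (𝔬12 x).G U = 1 := by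
    intro x hM α₀ hα ha U hU hU'
    have hM0 : M₀ ≤ (geo9Y x).M := (le_max_left _ _).trans hM
    have hMLσ : MLσ ≤ (geo9Y x).M := (le_max_right _ _).trans hM
    have ha0 : (geo9Y x).M * α₀ ≤ a₀ := ha.trans haPa
    have hgeo : GeoOK (geo9Y x) := ⟨geo9Y_dist_triangle x, geo9Y_dist_comm x, geo9K_dist_nonneg x.toKIdx, geo9Y_len_pos x⟩
    have hMα : 0 ≤ (geo9Y x).M * α₀ := mul_nonneg (hM₀.trans hM0) hα.le
    have hsmall : ∀ f : XBK (TrIdx N) x.toKIdx → ℝ, |f ⬝ᵥ (𝔬12 x).Tpi U f| ≤ r₁ * ((geo9Y x).M * α₀) * (f ⬝ᵥ (𝔬12 x).S0 U f) := by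
      intro f
      have h1 := abs_form_le_of_stepBlockBd (R₀ := 1) (H₀ := H x) hgeo (hrow x hMLσ) hσFT (mul_nonneg ht2L hMα) (htpi x hM0 α₀ hα ha0 U hU hU') f
      have h2 := weightedL2_le_form_of_l0 (R₀ := 1) (H₀ := H x) hgeo (hrow x hMLσ) hc'0 hσF0 hBL0 (hsym12 x hM0 α₀ hα ha0 U hU hU')
        (hpos12 x hM0 α₀ hα ha0 U hU hU') (hinvG0 x hM0 α₀ hα ha0 U hU hU') (hl0 x hM0 α₀ hα ha0 U hU hU') f
      calc |f ⬝ᵥ (𝔬12 x).Tpi U f| ≤ t2L * ((geo9Y x).M * α₀) * c' * ∑ y : (geo9Y x).Site, (((geo9Y x).len y)⁻¹ * bl2 (g := toB6 (geo9Y x) 1 (H x)) (𝔬12 x).blk y f) ^ 2 := h1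
        _ ≤ t2L * ((geo9Y x).M * α₀) * c' * (BL0 * c' * (f ⬝ᵥ (𝔬12 x).S0 U f)) :=
            mul_le_mul_of_nonneg_left h2 (mul_nonneg (mul_nonneg ht2L hMα) hc'0)
        _ = r₁ * ((geo9Y x).M * α₀) * (f ⬝ᵥ (𝔬12 x).S0 U f) := by rw [hr₁]; ring
    have hr1 : r₁ * ((geo9Y x).M * α₀) < 1 := by
      have ha3 : (geo9Y x).M * α₀ ≤ 1 / (2 * r₁ + 2) := ha.trans (min_le_right _ _)
      have h2 : 0 < 2 * r₁ + 2 := by positivity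
      calc r₁ * ((geo9Y x).M * α₀) ≤ r₁ * (1 / (2 * r₁ + 2)) := mul_le_mul_of_nonneg_left ha3 hr₁nn
        _ < 1 := by rw [mul_one_div, div_lt_one h2]; linarith
    -- the form smallness of the FLAT model (Δ⁽²⁾_π := 0) and the unit of Δ_a − Δ′_π at the pins
    have hF : FormSmall ({ 𝔬12 x with T2 := fun U => T2coK x.toKIdx (trBasis N) (bg9YR (Matrix (Fin N) (Fin N) ℂ) (specialUnitaryUnits (Fin N)) R₁ R₂ x) (fun U => U) (parSymY x.toKIdx) (GpPhysY x.toKIdx (parSymY x.toKIdx)) (0 : BondOpY (Matrix (Fin N) (Fin N) ℂ) x.toKIdx) U }) (r₁ * ((geo9Y x).M * α₀)) U := by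
      refine ⟨hpos12 x hM0 α₀ hα ha0 U hU hU', hsmall, fun f => ?_⟩
      show |f ⬝ᵥ ((𝔬12 x).Tpi U + T2coK x.toKIdx (trBasis N) (bg9YR (Matrix (Fin N) (Fin N) ℂ) (specialUnitaryUnits (Fin N)) R₁ R₂ x) (fun U => U) (parSymY x.toKIdx) (GpPhysY x.toKIdx (parSymY x.toKIdx)) (0 : BondOpY (Matrix (Fin N) (Fin N) ℂ) x.toKIdx) U) f| ≤ r₁ * ((geo9Y x).M * α₀) * (f ⬝ᵥ (𝔬12 x).S0 U f)
      rw [hT2z x U, add_zero]; exact hsmall f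
    have hUnit := isUnit_deltaPiAY_of_formSmall_phys x.toKIdx (bg9YR (Matrix (Fin N) (Fin N) ℂ) (specialUnitaryUnits (Fin N)) R₁ R₂ x) (fun U => U) _ U hN hF hr1 (hS0co12 x U) (hTpico12 x U)
    rw [hS0co12 x U, hTpico12 x U, hGco12 x U]
    exact S0coK_sub_TpicoK_mul_GcoK_GDY hcR hUnit
  -- PASS 1: the scaled sup letter of G_D (`gdsup_sq_of_pins_inv`), regime (MG, aG), aG ≤ aP
  obtain ⟨MG, aG, rG, haG0, haGP, hrG, hGD⟩ :=
    gdsup_sq_of_pins_inv (N := N) (M₀ := max M₀ MLσ) (H := H) (bI := bI) (hlev := hlev) (hβ1 := hβ1) (hbI0 := hbI0) (hGR := hGR) (c := c) (hM₀ := le_max_of_le_left hM₀) (hσ := hσ) (hτ := hτ) (w13 := w13)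
      (hw13₀ := hw13₀) (hw13₁ := hw13₁) (wX := wX) (hwX₀ := hwX₀) (hwX₁ := hwX₁) (hs440 := hs440) (hs441 := hs441) (hw1344 := hw1344) (hwX44 := hwX44) (bH13 := bH13) (hbH13 := hbH13)
      (hκ13 := hκ13) (bXH := bXH) (hbXH := hbXH) (bHXA := bHXA) (hbHXA := hbHXA) (bW := bW) (𝔬12 := 𝔬12) (hblk12 := hblk12) (hblkW12 := hblkW12) (hTpico12 := hTpico12) (hDvco12 := hDvco12)
      (hDvsco12 := hDvsco12) (𝔭A := 𝔭A) (hparB := hparB) (h𝔭A := h𝔭A) (Dd := Dd) (Dsd := Dsd) (hDd := hDd) (hGp := hGp) (hparS := hparS) (hB₀ := hB₀) (hCP := hCP) (htJ := htJ) (hB43 := hB43)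
      (htA := htA) (hB44 := hB44) (hB12₃ := hB12₃) (hBx13 := hBx13) (hBx13₀ := hBx13₀) (hwBx13 := hwBx13) (hB12₀ := hB12₀) (hBh12 := hBh12) (hBi := hBi) (hB₀G := hB₀G) (hBhG := hBhG)
      (hBHG := hBHG) (hwBhG := hwBhG) (hBd := hBd) (hCW := hCW) (hB₃ := hB₃) (hBhD := hBhD) (hBdX := hBdX) (hδK := hδK) (hr0 := hr0) (hr49 := hr49) (hr44 := hr44) (hrB := hrB) (hr43 := hr43)
      (hrT := hrT) (hK3d := hK3d) (hKP := hKP) (hP0 := hP0) (hP3 := hP3) (hPG := hPG) (h31 := fun x hM α₀ hα ha => h31 x ((le_max_left _ _).trans hM) α₀ hα (ha.trans haPa))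
      (h49 := fun x hM α₀ hα ha => h49 x ((le_max_left _ _).trans hM) α₀ hα (ha.trans haPa)) (h43 := fun x hM α₀ hα ha => h43 x ((le_max_left _ _).trans hM) α₀ hα (ha.trans haPa)) (h44G := fun x hM α₀ hα ha => h44G x ((le_max_left _ _).trans hM) α₀ hα (ha.trans haPa))
      (hta := fun x hM α₀ hα ha => hta x ((le_max_left _ _).trans hM) α₀ hα (ha.trans haPa)) (hBJ := fun x hM α₀ hα ha => hBJ x ((le_max_left _ _).trans hM) α₀ hα (ha.trans haPa)) (hZ81 := fun x hM α₀ hα ha => hZ81 x ((le_max_left _ _).trans hM) α₀ hα (ha.trans haPa))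
      (hpXDv := fun x hM α₀ hα ha => hpXDv x ((le_max_left _ _).trans hM) α₀ hα (ha.trans haPa)) (he0 := fun x hM α₀ hα ha => he0 x ((le_max_left _ _).trans hM) α₀ hα (ha.trans haPa))
      (he1d := fun x hM α₀ hα ha => he1d x ((le_max_left _ _).trans hM) α₀ hα (ha.trans haPa)) (he2 := fun x hM α₀ hα ha => he2 x ((le_max_left _ _).trans hM) α₀ hα (ha.trans haPa))
      (h43RG := fun x hM α₀ hα ha => h43RG x ((le_max_left _ _).trans hM) α₀ hα (ha.trans haPa)) (hgQs1 := fun x hM α₀ hα ha => hgQs1 x ((le_max_left _ _).trans hM) α₀ hα (ha.trans haPa))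
      (hpXQs := fun x hM α₀ hα ha => hpXQs x ((le_max_left _ _).trans hM) α₀ hα (ha.trans haPa)) (hDirR := fun x hM α₀ hα ha => hDirR x ((le_max_left _ _).trans hM) α₀ hα (ha.trans haPa))
      (hDir := fun x hM α₀ hα ha => hDir x ((le_max_left _ _).trans hM) α₀ hα (ha.trans haPa)) (hdgDvd := fun x hM α₀ hα ha => hdgDvd x ((le_max_left _ _).trans hM) α₀ hα (ha.trans haPa)) (htransW := fun x hM => htransW x ((le_max_left _ _).trans hM))
      (he1 := fun x hM α₀ hα ha => he1 x ((le_max_left _ _).trans hM) α₀ hα (ha.trans haPa)) (h43L := fun x hM α₀ hα ha => h43L x ((le_max_left _ _).trans hM) α₀ hα (ha.trans haPa))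
      (h43d := fun x hM α₀ hα ha => h43d x ((le_max_left _ _).trans hM) α₀ hα (ha.trans haPa)) (hdgDH := fun x hM α₀ hα ha => hdgDH x ((le_max_left _ _).trans hM) α₀ hα (ha.trans haPa))
      (hdgDHd := fun x hM α₀ hα ha => hdgDHd x ((le_max_left _ _).trans hM) α₀ hα (ha.trans haPa)) (hYd := fun x hM α₀ hα ha => hYd x ((le_max_left _ _).trans hM) α₀ hα (ha.trans haPa))
      (hXd := fun x hM α₀ hα ha => hXd x ((le_max_left _ _).trans hM) α₀ hα (ha.trans haPa)) (a₀ := aP) (ha₀ := haP0) (hinvG0 := fun x hM α₀ hα ha => hinvG0 x ((le_max_left _ _).trans hM) α₀ hα (ha.trans haPa))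
      (hinvG := hinvG) (hρG := hρG.le) (hρGP := hρGP) (hρGK := hρGK)
  have haGa : aG ≤ a₀ := haGP.trans haPa
  -- the (3.137) letter (`d2sup_of_pins`), regime (MD, aD)
  obtain ⟨MD, aD, θ₂, haD0, haDG, hθ₂0, hD2f⟩ := d2sup_of_pins (N := N) H 𝔠 hGR c hRP2 𝔬12 bI hbI0 hβ1 hblk12 hblkZ12 hGco12 hCco12 (MG := max M₀ MG)
    haG0 hrG hρG hBz hδC hδ₂ hκC hgap
    (fun x hM α₀ hα ha U hU hU' => hGD x ((le_max_right _ _).trans hM) α₀ hα ha U hU hU')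
    (fun x hM α₀ hα ha U hU hU' => hc2 x ((le_max_left _ _).trans hM) α₀ hα (ha.trans haGa) U hU hU')
    (fun x hM α₀ hα ha U hU hU' => hC2 x ((le_max_left _ _).trans hM) α₀ hα (ha.trans haGa) U hU hU')
  refine ⟨MD, aD, θ₂, haD0, haDG.trans haGa, hθ₂0, fun x hM α₀ hα ha U hU hU' => ?_⟩
  rw [hΔ2def x]
  exact hD2f x hM α₀ hα ha U hU hU'

end Summit.QuantumFields.YangMills.BalabanUVNodes.N06D2SupPrechainAtPinsPUW

end
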